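import Summits.ResolutionOfSingularities.ResolutionOfSingularities.Theses.HomologicalConductor
import Summits.ResolutionOfSingularities.ResolutionOfSingularities.Theorems.SyzygyFlatteningHigherRankTerminationEssFiniteType
import Summits.ResolutionOfSingularities.ResolutionOfSingularities.Theorems.HomologicalConductorPersistenceLocalisation
import Summits.ResolutionOfSingularities.ResolutionOfSingularities.Theorems.HomologicalConductorPersistenceInversion
import Summits.ResolutionOfSingularities.ResolutionOfSingularities.Theorems.HomologicalConductorPersistenceAffineChartEssFiniteType
import Summits.ResolutionOfSingularities.ResolutionOfSingularities.Theorems.HomologicalConductorPersistenceExistsMinimal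
import Summits.ResolutionOfSingularities.ResolutionOfSingularities.Theorems.HomologicalConductorPersistenceNrmAdjoinInv
import Summits.ResolutionOfSingularities.ResolutionOfSingularities.Theorems.HomologicalConductorPersistenceLocalStep
import Literature.RingTheory.CohomologyAnnihilator.Basic
import HarnessLib

/-!
# Crux `Persistence` (stmt-ResolutionOfSingularities-16484) — line `birth`, reshape 4 (DRAFT by the crux planner res-L1-w44b-plan-1, 2026-08-26; to be registered by the lead)

Route `ResolutionOfSingularities/HomologicalConductor`. The crux, BY NAME the route decl
`HomologicalConductor.Persistence`, is the monotonicity of the Iyengar–Takahashi cohomology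
annihilator `ca` along the canonical tower `T₀ = loc A`, `T_(m+1) = loc (nrm (chart T_m))`:
`∀ m, ca (T_m) ⊆ ca (T_(m+1))` (subsets of the common fraction field `K`).

## History of the line

* `birth` (planner): four stubs, one per kind of ring map in a tower step (chart /
  normalisation / localisation) plus the finiteness invariant.
* reshape 1 (lead, wave 1): the route's multi-`x` chart is a localisation of ONE affine blow-up
  chart (`chartWith_caK_eq_adjoin_inv`); finiteness of `nrm`/`loc` is in the tree
  (`Theorems.SyzygyFlattening.stub_essFiniteType_{nrm,locAt}`); five tree-vocabulary stubs, of
  which THREE LANDED in wave 1: `stub_localisationPersistence` (p166238,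
  `Theorems/HomologicalConductorPersistenceLocalisation.lean`), `stub_inversionPersistence`
  (p166513, `…PersistenceInversion.lean`), `stub_affineChartEssFiniteType` (p166722,
  `…PersistenceAffineChartEssFiniteType.lean`); `stub_normalisationPersistence` came back
  OPEN-in-print for non-Gorenstein rings of dimension ≥ 2 (worker aa5256…: Esentepe 2018 Thm 5.1
  needs Gorenstein + weak MCM-extending; a paper proof for Gorenstein `B` → CM finite birational
  `S` exists; explicit non-CM example `k + (x,z,y²)·A₃` CONFIRMS persistence).
* reshape 2: the two open legs (affine chart, normalisation) are MERGED into the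
  one statement the crux actually consumes — persistence on the NORMALISED affine chart,
  `ca B ⊆ ca (nrm (B[ca B/x]))` (weaker than the conjunction of the two legs: a non-normal
  point of the un-normalised chart can no longer kill the line) — using that normalisation
  commutes with adjoining inverses (`stub_nrm_adjoin_inv`, KNOWN) and that an element of
  minimal value exists as soon as `ca B ≠ 0` (`stub_exists_minimal`, KNOWN); when `ca B = 0`
  the inclusion is trivial (`0 ∈ ca` of anything), so no separate normalisation leg survives.
  Wave 2 LANDED both known stubs of reshape 2: `stub_exists_minimal` (p168613,
  `…PersistenceExistsMinimal.lean`), `stub_nrm_adjoin_inv` (p168860, `…PersistenceNrmAdjoinInv.lean`),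
  and two Literature tool files for the core: `Literature/RingTheory/Localization/BirationalLinearMaps.lean`
  (p169358: module maps over a birational extension are linear over the big ring) and
  `Literature/RingTheory/CohomologyAnnihilator/StableAnnihilation.lean` (p169606: stable
  annihilation ⇒ `Ext`-annihilation, dimension shifting, splitting criterion).
* reshape 3 (lead, 2026-08-17, sha 2f17a080…): the two landed stubs are imported; ONE stub remains, the
  GLOBAL normalised-chart statement `ca B ⊆ ca (nrm (B[ca B / x]))`.
* reshape 4 (this file, chain W4.4b): the core stub is RE-CUT to its LOCAL form at the centre of
  the valuation (refuter res-L1-w44b-tri-2, TRIAGE FS-1 + R1 audit 2026-08-26: crux-sufficient, and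
  crux-EQUIVALENT for honest kills — a counterexample needs `O` DOMINATING `B`, which the stub now
  carries; stub worker res-L1-w44b-stub-2 landed the drop-in glue `step_of_local_core`,
  `locAt_nrm_chart_eq` in `Theorems/HomologicalConductorPersistenceLocalStep.lean`, p459981, and the
  reductions `H_a_reduction` / `R1_iff_mem_loc`, p460879). The registered global statement implies the
  local one (tree `PersistenceLocalStep.mem_locAt_of_mem_nrm`), so every partial result toward reshape 3
  still feeds this line. Rungs landed for the re-cut core: dimension ≤ 1
  (`Theorems/HomologicalConductorPersistenceDimOne.lean`, the crux verbatim under `ringKrullDim A ≤ 1`).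

## Registered stub (1)

* `stub_localChartPersistence` (OPEN, the core, held by the lead): for `B ⊆ O` local, DOMINATED by
  `O` (`b ∈ B`, `b⁻¹ ∈ O ⇒ b⁻¹ ∈ B`), essentially of finite type over `k`, `Frac B = K`, and
  `x ∈ ca B`, `x ≠ 0` of minimal `O`-value on `ca B`: the ONE membership
  `x ∈ ca (loc_O (nrm (B[ca B / x])))` — `x` annihilates `Extⁱ` of finitely generated modules over
  the LOCAL ring of the normalised blow-up chart at the centre of `O`, for all `i ≫ 0`. Radically
  true (the normalised chart is regular off `V(x)`: tree `PersistenceAdjoinInv`, and IT14 Thm 5.4);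
  the content is the EXPONENT ONE; no theorem in print. Binding constraint from the toric record
  (CHAIN W4.4b v0.2): at the 331 toric near-misses `x ∉ ca^{d+1}` of the chart while the membership
  holds in higher `Ext`-degree, so no mechanism concluding `x ∈ ca^{d+1}` (Jacobian — IT16 Thm 1.2 —,
  Noether different, «kills every MCM module stably») can prove this stub; a proof must see the
  eventual image of the syzygy functor.

Composition (`Persistence_of`, sorry-free glue): the route goal is, by ζ/δ-reduction,
`caR (towerWith caR O A m) ⊆ caR (towerWith caR O A (m+1))`; rewrite `caR = caK` (image of the
Literature ideal, `Subalgebra.image_coe_cohomologyAnnihilator`); `tower_invariant` (`A ≤ T_m ⊆ O`,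
`T_m` local and essentially of finite type over `k`) by induction; one step is
`caK_subset_caK_step`: the landed `step_of_local_core` (route chart = affine chart with `O`-units
inverted; `nrm` commutes with inverting; `loc` absorbs inverted `O`-units; the degenerate case
`ca B = 0`; existence of an element of minimal value) reduces the step to the LOCAL core stub at
each admissible `x`; `tower_invariant` now also records that every stage is dominated by `O`
(`inv_mem_locAt_of_inv_mem`).
-/

-- single-problem summit: the doubled namespace component `ResolutionOfSingularities` is forced
set_option linter.dupNamespace false

noncomputable section

open Summit.ResolutionOfSingularities.ResolutionOfSingularities.Theses.HomologicalConductor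
open Summit.ResolutionOfSingularities.ResolutionOfSingularities.Theorems.SyzygyFlattening
  (locAt nrm self_le_locAt self_le_nrm locAt_toSubring_le nrm_toSubring_le isLocalRing_locAt
    adjoin_toSubring_le_valuationSubring stub_essFiniteType_locAt stub_essFiniteType_nrm
    mul_inv_mem_locAt locAt_locAt)
open Summit.ResolutionOfSingularities.ResolutionOfSingularities.Theorems.HomologicalConductor.PersistenceLocalisation
  (stub_localisationPersistence)
open Summit.ResolutionOfSingularities.ResolutionOfSingularities.Theorems.HomologicalConductor.PersistenceInversion
  (stub_inversionPersistence)
open Summit.ResolutionOfSingularities.ResolutionOfSingularities.Theorems.HomologicalConductor.PersistenceAffineChartEssFiniteType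
  (stub_affineChartEssFiniteType)
open Summit.ResolutionOfSingularities.ResolutionOfSingularities.Theorems.HomologicalConductor.PersistenceExistsMinimal
  (stub_exists_minimal)
open Summit.ResolutionOfSingularities.ResolutionOfSingularities.Theorems.HomologicalConductor.PersistenceNrmAdjoinInv
  (stub_nrm_adjoin_inv)
open Summit.ResolutionOfSingularities.ResolutionOfSingularities.Theorems.HomologicalConductor.PersistenceLocalStep
  (step_of_local_core)

namespace Summit.ResolutionOfSingularities.ResolutionOfSingularities.Cruxes.Persistence.Lines.Birth

/-! ## The one remaining stub (tree vocabulary only; signature registered verbatim) -/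

/-- **Stub (OPEN, the core; held by the lead): LOCAL persistence of `ca` on the normalised
affine blow-up chart of `ca` at `x`, at the centre of the valuation.** For `B ⊆ O` a local ring,
dominated by `O`, essentially of finite type over `k` with `Frac B = K`, and `x ∈ ca B`, `x ≠ 0`
with `c * x⁻¹ ∈ O` for all `c ∈ ca B` (minimal value): `x` lies in the image of
`ca (loc_O (nrm (B[ca B / x])))`, where `B[ca B/x] = k[B ∪ {c * x⁻¹ | c ∈ ca B}]`, `nrm` is the
integral closure in `K` and `loc_O` the localisation at the centre of `O` (tree `locAt`). Since
`ca B · C = x · C` upstairs and `ca` is an ideal, this ONE membership is the whole tower step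
(tree `step_of_local_core`). Implied by the reshape-3 global stub (tree `mem_locAt_of_mem_nrm`);
crux-equivalent for counterexamples with `O` dominating `B` (refuter audit, chain W4.4b).
Radically true; the content is the exponent one; any proof must go beyond `ca^{d+1}`
(toric near-misses). Nearest print: Esentepe 2018 Thm 5.1 (Gorenstein, weak MCM-extending);
structural analogue Lipman–Sathaye (Jacobian × normalisation ⊆ conductor).
[cite: Esentepe2018, Thm 5.1; LipmanSathaye1981; IyengarTakahashi2014, Def 2.1, Lemma 2.10] -/
theorem stub_localChartPersistence : ∀ (k K : Type) [Field k] [Field K] [Algebra k K]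
    (O : ValuationSubring K) (B : Subalgebra k K) (x : K), Algebra.EssFiniteType k ↥B →
    IsFractionRing ↥B K → IsLocalRing ↥B → B.toSubring ≤ O.toSubring →
    (∀ b : K, b ∈ B → b⁻¹ ∈ O → b⁻¹ ∈ B) →
    x ∈ ((↑) : ↥B → K) ''
      (Literature.RingTheory.CohomologyAnnihilator.cohomologyAnnihilator ↥B : Set ↥B) → x ≠ 0 →
    (∀ c ∈ ((↑) : ↥B → K) ''
      (Literature.RingTheory.CohomologyAnnihilator.cohomologyAnnihilator ↥B : Set ↥B), c * x⁻¹ ∈ O) →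
    x ∈ ((↑) : ↥(Summit.ResolutionOfSingularities.ResolutionOfSingularities.Theorems.SyzygyFlattening.locAt O
          (Summit.ResolutionOfSingularities.ResolutionOfSingularities.Theorems.SyzygyFlattening.nrm
            (Algebra.adjoin k ((B : Set K) ∪ {y : K | ∃ c ∈ ((↑) : ↥B → K) ''
              (Literature.RingTheory.CohomologyAnnihilator.cohomologyAnnihilator ↥B : Set ↥B),
              y = c * x⁻¹})))) → K) ''
      (Literature.RingTheory.CohomologyAnnihilator.cohomologyAnnihilator
        ↥(Summit.ResolutionOfSingularities.ResolutionOfSingularities.Theorems.SyzygyFlattening.locAt O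
          (Summit.ResolutionOfSingularities.ResolutionOfSingularities.Theorems.SyzygyFlattening.nrm
            (Algebra.adjoin k ((B : Set K) ∪ {y : K | ∃ c ∈ ((↑) : ↥B → K) ''
              (Literature.RingTheory.CohomologyAnnihilator.cohomologyAnnihilator ↥B : Set ↥B),
              y = c * x⁻¹})))) : Set _) := by
  sorry

/-! ## Glue: named pieces of the tower -/

variable {k K : Type} [Field k] [Field K] [Algebra k K]

/-- The image in `K` of the Literature cohomology annihilator ideal of `↥B`. [folklore] -/
def caK (B : Subalgebra k K) : Set K :=
  ((↑) : ↥B → K) '' (Literature.RingTheory.CohomologyAnnihilator.cohomologyAnnihilator ↥B :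
    Set ↥B)

/-- The route's inline `let ca`, verbatim. [cite: IyengarTakahashi2014, Def 2.1] -/
def caR (B : Subalgebra k K) : Set K :=
  {x : K | ∃ hx : x ∈ B, ∃ n : ℕ, ∀ i : ℕ, n ≤ i → ∀ (M N : ModuleCat.{0} ↥B),
    Module.Finite ↥B M → Module.Finite ↥B N →
    ∀ e : CategoryTheory.Abelian.Ext.{0} M N i, (⟨x, hx⟩ : ↥B) • e = 0}

/-- The route's inline `ca` is the image of the Literature ideal
(`Subalgebra.image_coe_cohomologyAnnihilator`, `u = 0`). [cite: IyengarTakahashi2014, Def 2.1] -/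
theorem caR_eq_caK : (caR : Subalgebra k K → Set K) = caK :=
  funext fun B => (Subalgebra.image_coe_cohomologyAnnihilator B).symm

/-- The route's `let chart`, parametrised by the annihilator function `ca`. [folklore] -/
def chartWith (ca : Subalgebra k K → Set K) (O : ValuationSubring K) (B : Subalgebra k K) :
    Subalgebra k K :=
  Algebra.adjoin k ((B : Set K) ∪ {y : K | ∃ c ∈ ca B, ∃ x ∈ ca B, x ≠ 0 ∧
    (∀ c' ∈ ca B, c' * x⁻¹ ∈ O) ∧ y = c * x⁻¹})

/-- The route's `let tower`, parametrised by `ca` (`loc`, `nrm` are the tree's `locAt`, `nrm`,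
verbatim the route's). [folklore] -/
def towerWith (ca : Subalgebra k K → Set K) (O : ValuationSubring K) (A : Subalgebra k K)
    (m : ℕ) : Subalgebra k K :=
  @Nat.rec (fun _ => Subalgebra k K) (locAt O A) (fun _ B => locAt O (nrm (chartWith ca O B))) m

/-- The affine blow-up chart `B[ca B / x]` inside `K`. [folklore] -/
def affChart (B : Subalgebra k K) (x : K) : Subalgebra k K :=
  Algebra.adjoin k ((B : Set K) ∪ {y : K | ∃ c ∈ caK B, y = c * x⁻¹})

/-- The elements of `ca B` of minimal `O`-value: `x ≠ 0` with `c * x⁻¹ ∈ O` for all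
`c ∈ ca B`. [folklore] -/
def minSet (O : ValuationSubring K) (B : Subalgebra k K) : Set K :=
  {x : K | x ∈ caK B ∧ x ≠ 0 ∧ ∀ c ∈ caK B, c * x⁻¹ ∈ O}

/-- The `O`-units `x * x₀⁻¹`, `x` of minimal value, for a fixed `x₀` of minimal value. [folklore] -/
def ratioSet (O : ValuationSubring K) (B : Subalgebra k K) (x₀ : K) : Set K :=
  {t : K | ∃ x ∈ minSet O B, t = x * x₀⁻¹}

/-- Computation rule of the tower at `0`. [folklore] -/
theorem towerWith_zero (ca : Subalgebra k K → Set K) (O : ValuationSubring K)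
    (A : Subalgebra k K) : towerWith ca O A 0 = locAt O A := rfl

/-- Computation rule of the tower at a successor. [folklore] -/
theorem towerWith_succ (ca : Subalgebra k K → Set K) (O : ValuationSubring K)
    (A : Subalgebra k K) (m : ℕ) :
    towerWith ca O A (m + 1) = locAt O (nrm (chartWith ca O (towerWith ca O A m))) := rfl

/-- `B ≤ chart B`. [folklore] -/
theorem self_le_chartWith (ca : Subalgebra k K → Set K) (O : ValuationSubring K)
    (B : Subalgebra k K) : B ≤ chartWith ca O B :=
  fun _ hb => Algebra.subset_adjoin (Or.inl hb)

/-- `B ≤ B[ca B / x]`. [folklore] -/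
theorem self_le_affChart (B : Subalgebra k K) (x : K) : B ≤ affChart B x :=
  fun _ hb => Algebra.subset_adjoin (Or.inl hb)

/-- For `B ⊆ O` (and `k ⊆ O`) the chart lies in `O`: the adjoined `c * x⁻¹` are in `O` by the
minimality of `x`. [folklore] -/
theorem chartWith_toSubring_le (O : ValuationSubring K) {B : Subalgebra k K}
    (hk : ∀ c : k, algebraMap k K c ∈ O) (hB : B.toSubring ≤ O.toSubring) :
    (chartWith caK O B).toSubring ≤ O.toSubring := by
  refine adjoin_toSubring_le_valuationSubring O hk ?_
  rintro y (hy | ⟨c, hc, x, -, -, hmin, rfl⟩)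
  · exact hB (Subalgebra.mem_toSubring.mpr hy)
  · exact hmin c hc

/-- The ratios `x * x₀⁻¹` of elements of minimal value lie in the affine chart at `x₀`. [folklore] -/
theorem ratioSet_subset_affChart (O : ValuationSubring K) (B : Subalgebra k K) (x₀ : K) :
    ratioSet O B x₀ ⊆ ↑(affChart B x₀) := by
  rintro t ⟨x, hx, rfl⟩
  exact Algebra.subset_adjoin (Or.inr ⟨x, hx.1, rfl⟩)

/-- **The route's chart is a localisation of one affine chart.** If `x₀ ∈ ca B` has minimal
`O`-value, then `chart B = (B[ca B/x₀])[(x * x₀⁻¹)⁻¹ | x of minimal value]`: every generator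
`c * x⁻¹` is `(c * x₀⁻¹) * (x * x₀⁻¹)⁻¹`, and conversely `(x * x₀⁻¹)⁻¹ = x₀ * x⁻¹` is a
generator of the chart. [folklore] -/
theorem chartWith_caK_eq_adjoin_inv (O : ValuationSubring K) (B : Subalgebra k K) {x₀ : K}
    (hx₀ : x₀ ∈ minSet O B) :
    chartWith caK O B =
      Algebra.adjoin k ((affChart B x₀ : Set K) ∪ {y : K | ∃ t ∈ ratioSet O B x₀, y = t⁻¹}) := by
  obtain ⟨hx₀ca, hx₀0, hx₀min⟩ := hx₀
  refine le_antisymm ?_ ?_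
  · refine Algebra.adjoin_le ?_
    rintro y (hy | ⟨c, hc, x, hx, hx0, hmin, rfl⟩)
    · exact Algebra.subset_adjoin (Or.inl (self_le_affChart B x₀ hy))
    · have hcx : c * x⁻¹ = (c * x₀⁻¹) * (x * x₀⁻¹)⁻¹ := by
        rw [mul_inv_rev, inv_inv, mul_assoc, ← mul_assoc x₀⁻¹, inv_mul_cancel₀ hx₀0, one_mul]
      rw [hcx]
      refine mul_mem ?_ ?_
      · exact Algebra.subset_adjoin (Or.inl (Algebra.subset_adjoin (Or.inr ⟨c, hc, rfl⟩)))
      · exact Algebra.subset_adjoin (Or.inr ⟨x * x₀⁻¹, ⟨x, ⟨hx, hx0, hmin⟩, rfl⟩, rfl⟩)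
  · refine Algebra.adjoin_le ?_
    rintro y (hy | ⟨t, ⟨x, ⟨hx, hx0, hmin⟩, rfl⟩, rfl⟩)
    · revert hy y
      change affChart B x₀ ≤ chartWith caK O B
      refine Algebra.adjoin_le ?_
      rintro y (hy | ⟨c, hc, rfl⟩)
      · exact Algebra.subset_adjoin (Or.inl hy)
      · exact Algebra.subset_adjoin (Or.inr ⟨c, hc, x₀, hx₀ca, hx₀0, hx₀min, rfl⟩)
    · have hinv : (x * x₀⁻¹)⁻¹ = x₀ * x⁻¹ := by rw [mul_inv_rev, inv_inv]
      rw [hinv]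
      exact Algebra.subset_adjoin (Or.inr ⟨x₀, hx₀ca, x, hx, hx0, hmin, rfl⟩)

/-- **The route's chart stays essentially of finite type** (landed stubs: affine chart,
inversion; or trivially when there is no element of minimal value). [folklore] -/
theorem essFiniteType_chartWith (O : ValuationSubring K) (B : Subalgebra k K)
    [hB : Algebra.EssFiniteType k ↥B] : Algebra.EssFiniteType k ↥(chartWith caK O B) := by
  by_cases h : ∃ x₀, x₀ ∈ minSet O B
  · obtain ⟨x₀, hx₀⟩ := h
    rw [chartWith_caK_eq_adjoin_inv O B hx₀]
    have h2 : Algebra.EssFiniteType k ↥(affChart B x₀) :=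
      stub_affineChartEssFiniteType k K B x₀ hB
    exact (stub_inversionPersistence k K (affChart B x₀) (ratioSet O B x₀)
      (ratioSet_subset_affChart O B x₀)).1 h2
  · have hBeq : chartWith caK O B = B := by
      refine le_antisymm (Algebra.adjoin_le ?_) (self_le_chartWith caK O B)
      rintro y (hy | ⟨c, -, x, hx, hx0, hmin, rfl⟩)
      · exact hy
      · exact absurd ⟨x, hx, hx0, hmin⟩ h
    rw [hBeq]
    exact hB

/-- A finitely generated `k`-subalgebra of `K` is essentially of finite type over `k`. [folklore] -/
theorem essFiniteType_of_fg (A : Subalgebra k K) (hA : A.FG) : Algebra.EssFiniteType k ↥A := by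
  haveI : Algebra.FiniteType k ↥A := (Subalgebra.fg_iff_finiteType A).mp hA
  infer_instance

/-- **Every stage of the tower is dominated by `O`**: for `R ⊆ O`, an element of `loc_O R`
whose inverse lies in `O` has its inverse in `loc_O R` (`b⁻¹ = 1 * b⁻¹` is a generator of
`loc_O (loc_O R) = loc_O R`, tree `locAt_locAt`). [folklore] -/
theorem inv_mem_locAt_of_inv_mem (O : ValuationSubring K) (R : Subalgebra k K)
    (hRO : R.toSubring ≤ O.toSubring) {b : K} (hb : b ∈ locAt O R) (hbO : b⁻¹ ∈ O) :
    b⁻¹ ∈ locAt O R := by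
  have h := mul_inv_mem_locAt O (locAt O R) (Subalgebra.one_mem _) hb hbO
  rwa [one_mul, locAt_locAt O R hRO] at h

/-- **One step of the tower** `ca B ⊆ ca (loc (nrm (chart B)))` for a stage `B`: the landed
`step_of_local_core` reduces it to the LOCAL core stub at each `x ∈ ca B` of minimal value.
[folklore] -/
theorem caK_subset_caK_step (O : ValuationSubring K)
    {A B : Subalgebra k K} (hAB : A ≤ B) (hBO : B.toSubring ≤ O.toSubring)
    (hdom : ∀ b : K, b ∈ B → b⁻¹ ∈ O → b⁻¹ ∈ B)
    (hF : IsFractionRing ↥A K) (hBft : Algebra.EssFiniteType k ↥B) (hBloc : IsLocalRing ↥B) :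
    caK B ⊆ caK (locAt O (nrm (chartWith caK O B))) := by
  haveI := hF
  haveI := hBft
  have hBnoeth : IsNoetherianRing ↥B := Algebra.EssFiniteType.isNoetherianRing k _
  have hBfrac : IsFractionRing ↥B K :=
    Literature.AlgebraicGeometry.Resolution.isFractionRing_subalgebra_of_le A B hAB
  exact step_of_local_core O B hBO hBnoeth fun x₀ hx₀ hx0 hmin =>
    stub_localChartPersistence k K O B x₀ hBft hBfrac hBloc hBO hdom hx₀ hx0 hmin

/-- **The invariant of the tower**: every stage contains `A`, lies in `O`, is essentially of
finite type over `k` and is a local ring (induction: the chart by `essFiniteType_chartWith`,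
the normalisation by E. Noether's finiteness — tree `stub_essFiniteType_nrm` — and the
localisation at the centre by tree `stub_essFiniteType_locAt`, `isLocalRing_locAt`).
[cite: Liu2002, Prop. 4.1.27] -/
theorem tower_invariant (O : ValuationSubring K) (A : Subalgebra k K)
    (hk : ∀ c : k, algebraMap k K c ∈ O) (hA : A.FG) (hF : IsFractionRing ↥A K)
    (hO : A.toSubring ≤ O.toSubring) (m : ℕ) :
    A ≤ towerWith caK O A m ∧ (towerWith caK O A m).toSubring ≤ O.toSubring ∧
      Algebra.EssFiniteType k ↥(towerWith caK O A m) ∧ IsLocalRing ↥(towerWith caK O A m) ∧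
      (∀ b : K, b ∈ towerWith caK O A m → b⁻¹ ∈ O → b⁻¹ ∈ towerWith caK O A m) := by
  induction m with
  | zero =>
    rw [towerWith_zero]
    exact ⟨self_le_locAt O A, locAt_toSubring_le O hk hO,
      stub_essFiniteType_locAt k K O A hO hF (essFiniteType_of_fg A hA), isLocalRing_locAt O A hO,
      fun b hb hbO => inv_mem_locAt_of_inv_mem O A hO hb hbO⟩
  | succ m ih =>
    obtain ⟨hAB, hBO, hBft, -, -⟩ := ih
    rw [towerWith_succ]
    set B := towerWith caK O A m
    haveI := hBft
    haveI := hF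
    -- the chart
    have hAC : A ≤ chartWith caK O B := hAB.trans (self_le_chartWith caK O B)
    have hCO : (chartWith caK O B).toSubring ≤ O.toSubring := chartWith_toSubring_le O hk hBO
    have hCft : Algebra.EssFiniteType k ↥(chartWith caK O B) := essFiniteType_chartWith O B
    have hCfrac : IsFractionRing ↥(chartWith caK O B) K :=
      Literature.AlgebraicGeometry.Resolution.isFractionRing_subalgebra_of_le A _ hAC
    -- the normalisation
    have hAN : A ≤ nrm (chartWith caK O B) := hAC.trans (self_le_nrm _)
    have hNO : (nrm (chartWith caK O B)).toSubring ≤ O.toSubring := nrm_toSubring_le O hk hCO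
    have hNft : Algebra.EssFiniteType k ↥(nrm (chartWith caK O B)) :=
      stub_essFiniteType_nrm k K _ hCfrac hCft
    have hNfrac : IsFractionRing ↥(nrm (chartWith caK O B)) K :=
      Literature.AlgebraicGeometry.Resolution.isFractionRing_subalgebra_of_le A _ hAN
    -- the localisation at the centre
    exact ⟨hAN.trans (self_le_locAt O _), locAt_toSubring_le O hk hNO,
      stub_essFiniteType_locAt k K O _ hNO hNfrac hNft, isLocalRing_locAt O _ hNO,
      fun b hb hbO => inv_mem_locAt_of_inv_mem O _ hNO hb hbO⟩

/-- **Persistence along the tower, for the image of the Literature ideal.** [folklore] -/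
theorem persistence_caK (O : ValuationSubring K) (A : Subalgebra k K)
    (hk : ∀ c : k, algebraMap k K c ∈ O) (hA : A.FG) (hF : IsFractionRing ↥A K)
    (hO : A.toSubring ≤ O.toSubring) (m : ℕ) :
    caK (towerWith caK O A m) ⊆ caK (towerWith caK O A (m + 1)) := by
  obtain ⟨hAB, hBO, hBft, hBloc, hdom⟩ := tower_invariant O A hk hA hF hO m
  rw [towerWith_succ]
  exact caK_subset_caK_step O hAB hBO hdom hF hBft hBloc

/-! ## The composition: the crux from the stubs -/

/-- **The crux `Persistence`, assembled from the registered stubs** (the skeleton theorem: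
concludes the route decl BY NAME). The route's `let`-bound goal is definitionally
`caR (towerWith caR O A m) ⊆ caR (towerWith caR O A (m+1))`; rewrite the inline annihilator
`caR` into the image `caK` of the Literature ideal and apply `persistence_caK`. The only
`sorry` in its closure is the core stub `stub_localChartPersistence`. [folklore] -/
theorem Persistence_of : Persistence := by
  intro p hp k K _ _ _ _ O A hk hA hF hO
  show ∀ m : ℕ, caR (towerWith caR O A m) ⊆ caR (towerWith caR O A (m + 1))
  rw [caR_eq_caK]
  exact persistence_caK O A hk hA hF hO

end Summit.ResolutionOfSingularities.ResolutionOfSingularities.Cruxes.Persistence.Lines.Birth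

end
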